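import Literature.MathematicalPhysics.QuantumFieldTheory.Balaban1983to89.B9SupplySockB9P3ZdGamma

/-!
# `Balaban1983to89.B8CubeMemberLamBPrimeLaws` — [Balaban1985RegularSpaces] (1.31) p. 82 ∕ [Balaban1984PropagatorsII] (2.3) p. 224: the Theorem-4 driver's
# two CLASS LAWS for print's (split) constraint-bond class `cubeLamBP'` of the cube member of (1.131) — the γ box law «box ⊂ □_{j−1}» and the
# inner ∕ crossing ∕ mirrored-crossing trichotomy w.r.t. the restriction tower `cubeLamS`

statement-level skeleton of published theorems with citation tags; proofs where landed; nothing here is a claim about the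
Yang–Mills mass gap

T. Bałaban, *Spaces of regular gauge field configurations on a lattice and gauge fixing conditions*, Commun. Math. Phys. **99** (1985) 75–102
`[Balaban1985RegularSpaces]` ("B8"): (1.31) p. 82 («All sites of the contours Γ_{b₋,x} belong to Λ_{j−1}»), (1.5) p. 77, (1.131) p. 99, p. 98 («a distance between
boundaries of these cubes is equal to R₁M₁Lʲη»); T. Bałaban, *Propagators and renormalization transformations for lattice gauge theories. II*, Commun. Math.
Phys. **96** (1984) 223–250 `[Balaban1984PropagatorsII]` ("B6"): (2.3) p. 224 (the constraint-bond class «at least one end-point in Ω_j^{(j)}»).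
PDF held: `paper:balaban1985-cmp99-regular-spaces-gauge-fixing` (journal page = PDF page + 74).

CITATION HEADER (lean-in-tree rule).  Cell `pub-ymgap` (HUMAN RULING D-0062, Track A), DAG node N05 = [B8]; width seat `pub-ymgap-k0-s2-w1` (g0; K0⁷ stub 2 = [6] Prop. 6
at NODE 00's cube member; dag-n05-e g9 HAND-OUT «D2γ + Aγ», bus 2026-08-27 23:16Z; dag-lead DEDUP-357 (1)).  WHY THIS FILE.  The edition-γ Theorem-4 driver
(`B8Eq142KLevelLocalGamma.H42_of_inAx_γ`, `B8Thm4KLevelGamma.norm_B1_lt_kLevel_γ`, `B8Thm4ExistsConcreteGamma.thm4Exists_concrete_uniform_γ`) takes the datum class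
`Λb m j` as a PARAMETER under two laws: `hbox` — the locality box of a level-`j` datum bond lies in `Ω_{j−1}` (level `0`: `Ω₀`) — and `hclass` — every datum bond is
INNER (both ends in `Λs m j`), CROSSING (`c₊ ∈ Λs m j`, the `L`-block of `c₋` in `Λs m (j−1)`) or MIRRORED-CROSSING.  At the cube member of (1.131) the class of record
in edition γ is dag-n05-e's split class `B9SupplySockB9P3ZdGamma.cubeLamBP'` (dag-n06-b p579891: level `0` = the inner class `cubeLamB … m 0`, levels `j ≥ 1` =
dag-n05-c's print class `B8Ineq159FlatCubeMemberPrinted.cubeLamBP … m j` = «at least one end in `□_j^{(j)}`, no end in `□_{j+1}^{(j)}` if `j < m`»), the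
restriction tower is `B8CubeMemberZd.cubeLamS` and `Ω_j = cubeFam false … j`.  THIS FILE proves the two laws for that class (dag-n05-e's «(L1)» and «(L2)
`cubeLamBP'_hclass`»), so that the γ cube instantiation of Proposition 6 (`B8Prop6CubeMemberNormsGamma` ∕ `B8Prop6CubeMemberGaugedGamma`) can call the driver.

WHAT IS PROVED (kernel, 0 sorry; theorems only, no `def`).
§1 coordinates: `inLo_apply_eq` ∕ `inHi_apply_eq` (`□_{j+1}^{(j)}` = `□_j^{(j)}` shrunk by `ρ` on every side), `sqLo_succ_blowup` ∕ `sqHi_succ_blowup`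
   (`L·□_{j+1}^{(j+1)}` = `□_{j+1}^{(j)}`, from r05's `B8Eq131Cubes.inner_eq_blowup`).
§2 ★ `cubeLamBP'_hbox_pred` — the γ BOX LAW: `∀ m ≤ k, ∀ j ≤ m, ∀ c ∈ cubeLamBP' … m j`, the box `Bʲ(c₋) ∪ Bʲ(c₊)` lies in `cubeFam false … (j − 1)` (level `0`:
   `cubeLamB`'s own law; levels `j ≥ 1`: dag-n05-c's `cubeLamBP_box_subset_pred`, `L ≤ ρ`).
§3 ★★ `cubeLamBP'_hclass` — the TRICHOTOMY w.r.t. `cubeLamS … m` (`L ≤ ρ`, `1 ≤ L`): at level `0` `cubeLamB`'s own law; at level `j = n+1 ≤ m ≤ k` a bond of print's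
   class with both ends in `□_j^{(j)}` is inner, and a bond with exactly one end in `□_j^{(j)}` is crossing ∕ mirrored-crossing — the `L`-block of the outer end lies
   in `Λ_n = □_n^{(n)} ∖ □_{n+1}^{(n)}` because `□_{n+1}^{(n)}` is `□_n^{(n)}` shrunk by `ρ ≥ L` (print: the collar `R₁M₁Lⁿη ≥ L·Lⁿη`) and is the `L`-blow-up of
   `□_{n+1}^{(n+1)}` (block compatibility).
§4 `seesDom` ∕ box law packaged for the member: `cubeLamBP'_laws` (the pair, for citation).

HONEST SCOPE.  Lattice-geometry bookkeeping on r05's ∕ dag-n05-c's ∕ dag-n06-b's typed objects; no estimate; nothing of [Balaban1985RegularSpaces] asserted beyond the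
geometry of (1.131).  Count-neutral; N05 ∕ K0⁷ stub 2 NOT discharged; one finite `𝕋⁴` programme at fixed `ε`, Bałaban AS PRINTED; nothing continuum ∕ ℝ⁴ ∕ OS ∕ mass-gap ∕
Clay (the Yang–Mills mass gap is NOT proved by any of this; route R4 closes the conditional finite-𝕋⁴ rung `BalabanLadder.UV` only).  No `sorry`, no `def`, no `instance`,
no `notation`.  Unit `pub-ymgap-k0-s2-w1` (g0), 2026-08-27.

RELATED IN THE TREE, NOT DUPLICATED (USED by name): `B9SupplySockB9P3ZdGamma.{cubeLamBP', cubeLamBP'_zero, cubeLamBP'_of_ne_zero, seesDom_cubeLamBP'}` (dag-n06-b ∕ dag-n05-e),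
`B8Ineq159FlatCubeMemberPrinted.{cubeLamBP, mem_cubeLamBP_iff, cubeLamBP_box_subset_pred}` (dag-n05-c), `B8CubeMemberZd.{cubeLamS, cubeLam, cubeLamS_of_lt, cubeLamS_self,
hbox_cubeLamB, hclass_cubeLamB}` (dag-n05-c), `B8Eq131Cubes.{sqLo, sqHi, inLo, inHi, inner_eq_blowup, one_le_gs}`, `B8Eq131CubesAdmissible.cubeFam_false_of_le` (r05),
`B8Thm2LogB.blockTop`.
-/

noncomputable section

namespace Literature.MathematicalPhysics.QuantumFieldTheory.Balaban1983to89.B8CubeMemberLamBPrimeLaws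

open B7Prop1Explicit B7Prop1Local B8Ineq130
open B8Ineq130 (tlo thi tlo_apply thi_apply)
open B8Thm2LogB (blockTop)
open B8Eq131Cubes (cube sqLo sqHi inLo inHi bLo bHi gs one_le_gs inner_eq_blowup)
open B8Eq131CubesAdmissible (cubeFam cubeFam_false_of_le)
open B8CubeMemberZd (cubeLamS cubeLam cubeLamB cubeLamS_of_lt cubeLamS_self hbox_cubeLamB hclass_cubeLamB)
open B8Ineq159FlatCubeMemberPrinted (cubeLamBP mem_cubeLamBP_iff cubeLamBP_box_subset_pred)
open B9SupplySockB9P3ZdGamma (cubeLamBP' cubeLamBP'_zero cubeLamBP'_of_ne_zero)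

-- `Site` alone could resolve to the torus sites of `Setup.lean`; re-export the `ℤ^d` sites of `B7Prop1Explicit`.
export B7Prop1Explicit (Site)

variable {d : ℕ}

/-! ## §1 Coordinates of `□_j^{(j)}`, `□_{j+1}^{(j)}` -/

/-- `□_{j+1}^{(j)}` is `□_j^{(j)}` shrunk by the collar `ρ` — lower corner. [cite: Balaban1985RegularSpaces, (1.131) p.99, p.98 («a distance between boundaries of these cubes is equal to R₁M₁Lʲη»)] -/
theorem inLo_apply_eq (L : ℕ) (a : Site d) (ρ k j : ℕ) (i : Fin d) : inLo L a ρ k j i = sqLo L a ρ k j i + ρ := by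
  have hg := one_le_gs L (k - j)
  simp only [inLo, sqLo, bLo]
  push_cast [Nat.cast_sub hg]
  ring

/-- `□_{j+1}^{(j)}` is `□_j^{(j)}` shrunk by the collar `ρ` — upper corner. [cite: Balaban1985RegularSpaces, (1.131) p.99, p.98] -/
theorem inHi_apply_eq (L : ℕ) (a : Site d) (M ρ k j : ℕ) (i : Fin d) : inHi L a M ρ k j i = sqHi L a M ρ k j i - ρ := by
  have hg := one_le_gs L (k - j)
  simp only [inHi, sqHi, bHi]
  push_cast [Nat.cast_sub hg]
  ring

/-- Block compatibility: `□_{n+1}^{(n)}` is the `L`-blow-up of `□_{n+1}^{(n+1)}` — lower corner (`n < k`). [cite: Balaban1985RegularSpaces, p.98 («for every j the cube □_j is a sum of the big blocks»), (1.131) p.99] -/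
theorem sqLo_succ_blowup {L : ℕ} (a : Site d) (ρ : ℕ) {k n : ℕ} (hn : n < k) (i : Fin d) :
    (L : ℤ) * sqLo L a ρ k (n + 1) i = sqLo L a ρ k n i + ρ := by
  have h := congrFun (inner_eq_blowup (L := L) a 0 ρ hn).1 i
  rw [tlo_apply, pow_one] at h
  rw [← h, inLo_apply_eq]

/-- Block compatibility — upper corner (`n < k`): `L·(sqHi (n+1) + 1) − 1 = sqHi n − ρ`. [cite: Balaban1985RegularSpaces, p.98, (1.131) p.99] -/
theorem sqHi_succ_blowup {L : ℕ} (a : Site d) (M ρ : ℕ) {k n : ℕ} (hn : n < k) (i : Fin d) :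
    (L : ℤ) * (sqHi L a M ρ k (n + 1) i + 1) - 1 = sqHi L a M ρ k n i - ρ := by
  have h := congrFun (inner_eq_blowup (L := L) a M ρ hn).2 i
  rw [thi_apply, pow_one] at h
  rw [← h, inHi_apply_eq]

/-! ## §2 The γ box law «box ⊂ □_{j−1}» for the split class -/

/-- ★ **THE γ BOX LAW FOR `cubeLamBP'`**: for `m ≤ k`, `j ≤ m` and every datum bond `c ∈ cubeLamBP' … m j`, the locality box `Bʲ(c₋) ∪ Bʲ(c₊)` lies in
`cubeFam false … (j − 1)` = `□_{j−1}` (Lean's `0 − 1 = 0`: at level `0` in `□₀`, by `cubeLamB`'s own law; at `j ≥ 1` by dag-n05-c's `cubeLamBP_box_subset_pred`,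
`L ≤ ρ`) — VERBATIM the `hbox` binder of `H42_of_inAx_γ` ∕ `thm4Exists_concrete_uniform_γ` at `(Ω, Λb) := (cubeFam false L a M ρ k, cubeLamBP' L a M ρ k)`.
[cite: Balaban1985RegularSpaces, (1.31) p.82 («Γ_{b₋,x} ⊂ Λ_{j−1}»), (1.131) p.99; Balaban1984PropagatorsII, (2.3) p.224] -/
theorem cubeLamBP'_hbox_pred {L : ℕ} (hL : 1 ≤ L) (a : Site d) (M : ℕ) {ρ : ℕ} (hρ : L ≤ ρ) (k : ℕ) :
    ∀ m, m ≤ k → ∀ j, j ≤ m → ∀ c ∈ cubeLamBP' L a M ρ k m j, ∀ x,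
      InBox (loK L j c.1) (bondHiK L j c.1 c.2) x → x ∈ cubeFam false L a M ρ k (j - 1) := by
  intro m hm j hj c hc x hx
  rcases Nat.eq_zero_or_pos j with rfl | hj1
  · rw [cubeLamBP'_zero] at hc
    exact hbox_cubeLamB L a M ρ k m hm 0 hj c hc x hx
  · rw [cubeLamBP'_of_ne_zero L a M ρ k m (Nat.pos_iff_ne_zero.mp hj1)] at hc
    rw [cubeFam_false_of_le L a M ρ ((Nat.sub_le j 1).trans (hj.trans hm))]
    exact cubeLamBP_box_subset_pred hL a M hρ hj1 hm hc x hx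

/-! ## §3 The trichotomy w.r.t. the restriction tower `cubeLamS` -/

/-- A site of `□_j^{(j)}` (not in `□_{j+1}^{(j)}` when `j < m`) lies in `cubeLamS … m j` (`j ≤ m ≤ k`). [cite: Balaban1985RegularSpaces, (1.5) p.77, (1.68) p.88, (1.131) p.99] -/
theorem mem_cubeLamS_of_inBox (L : ℕ) (a : Site d) (M ρ : ℕ) {k m j : ℕ} (hjm : j ≤ m) (hmk : m ≤ k) {z : Site d}
    (hz : InBox (sqLo L a ρ k j) (sqHi L a M ρ k j) z) (hdeep : j < m → ¬ InBox (inLo L a ρ k j) (inHi L a M ρ k j) z) :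
    z ∈ cubeLamS L a M ρ k m j := by
  rcases Nat.lt_or_ge j m with h | h
  · rw [cubeLamS_of_lt L a M ρ k h]
    exact ⟨hz, fun _ => hdeep h⟩
  · have hjm' : j = m := le_antisymm hjm h
    subst hjm'
    rw [cubeLamS_self]
    exact hz

/-- **THE `L`-BLOCK UNDER A LEVEL-`(n+1)` SITE ADJACENT TO `□_{n+1}^{(n+1)}` BUT OUTSIDE IT LIES IN `Λ_n`** (`n + 1 ≤ m ≤ k`, `L ≤ ρ`): if `w ∈ □_{n+1}^{(n+1)}`, `v ∉ □_{n+1}^{(n+1)}`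
and `v`, `w` differ by a unit vector (`v = w − e_κ` or `v = w + e_κ`), then every level-`n` site `x` with `L•v ≤ x ≤ L•v + (L−1)𝟙` lies in `cubeLamS … m n` — inside
`□_n^{(n)}` (collar `ρ ≥ L`) and outside `□_{n+1}^{(n)} = L·□_{n+1}^{(n+1)}` (else `v ∈ □_{n+1}^{(n+1)}`).
[cite: Balaban1985RegularSpaces, (1.31) p.82, (1.5) p.77, p.98, (1.131) p.99] -/
theorem block_mem_cubeLamS_of_adjacent {L : ℕ} (hL : 1 ≤ L) (a : Site d) (M : ℕ) {ρ : ℕ} (hρ : L ≤ ρ) {k m n : ℕ} (hnm : n + 1 ≤ m) (hmk : m ≤ k)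
    {v w : Site d} (hw : InBox (sqLo L a ρ k (n + 1)) (sqHi L a M ρ k (n + 1)) w) (hv : ¬ InBox (sqLo L a ρ k (n + 1)) (sqHi L a M ρ k (n + 1)) v)
    (hadj : ∀ i, w i - 1 ≤ v i ∧ v i ≤ w i + 1) :
    ∀ x, (L : ℤ) • v ≤ x → x ≤ (L : ℤ) • v + blockTop L → x ∈ cubeLamS L a M ρ k m n := by
  intro x hx1 hx2
  have hnk : n < k := by omega
  have hLz : (0 : ℤ) < (L : ℤ) := by exact_mod_cast hL
  have hρz : (L : ℤ) ≤ (ρ : ℤ) := by exact_mod_cast hρ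
  have hx : ∀ i, (L : ℤ) * v i ≤ x i ∧ x i ≤ (L : ℤ) * v i + ((L : ℤ) - 1) := fun i => by
    have h1 := hx1 i
    have h2 := hx2 i
    simp only [Pi.smul_apply, smul_eq_mul, Pi.add_apply, blockTop] at h1 h2
    exact ⟨h1, h2⟩
  refine mem_cubeLamS_of_inBox L a M ρ (by omega) hmk (fun i => ?_) (fun _ hin => hv fun i => ?_)
  · -- `x ∈ □_n^{(n)}`: the block of `v` is the block of `w` shifted by at most one block, and the collar is `ρ ≥ L`
    obtain ⟨hw1, hw2⟩ := hw i
    obtain ⟨ha1, ha2⟩ := hadj i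
    obtain ⟨hx1, hx2⟩ := hx i
    have e1 := sqLo_succ_blowup (L := L) a ρ hnk i
    have e2 := sqHi_succ_blowup (L := L) a M ρ hnk i
    constructor
    · nlinarith [mul_le_mul_of_nonneg_left hw1 hLz.le, mul_le_mul_of_nonneg_left ha1 hLz.le]
    · nlinarith [mul_le_mul_of_nonneg_left hw2 hLz.le, mul_le_mul_of_nonneg_left ha2 hLz.le]
  · -- `x ∈ □_{n+1}^{(n)} = L·□_{n+1}^{(n+1)}` would put `v` in `□_{n+1}^{(n+1)}`
    obtain ⟨hi1, hi2⟩ := hin i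
    obtain ⟨hx1, hx2⟩ := hx i
    rw [inLo_apply_eq] at hi1
    rw [inHi_apply_eq] at hi2
    have e1 := sqLo_succ_blowup (L := L) a ρ hnk i
    have e2 := sqHi_succ_blowup (L := L) a M ρ hnk i
    have h1 : (L : ℤ) * sqLo L a ρ k (n + 1) i < (L : ℤ) * (v i + 1) := by nlinarith
    have h2 : (L : ℤ) * v i < (L : ℤ) * (sqHi L a M ρ k (n + 1) i + 1) := by nlinarith
    have h1' := lt_of_mul_lt_mul_left h1 hLz.le
    have h2' := lt_of_mul_lt_mul_left h2 hLz.le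
    constructor <;> omega

/-- ★★ **THE TRICHOTOMY LAW FOR `cubeLamBP'`** w.r.t. the restriction tower `cubeLamS … m` (`1 ≤ L ≤ ρ`): every datum bond of the split class at truncation `m ≤ k`, level `j ≤ m`,
is INNER (both ends in `cubeLamS … m j`), CROSSING (`j = n+1`, the `L`-block of `c₋` in `cubeLamS … m n`, `c₊ ∈ cubeLamS … m j`) or MIRRORED-CROSSING — VERBATIM the `hclass`
binder of `H42_of_inAx_γ` ∕ `thm4Exists_concrete_uniform_γ` at `(Λs, Λb) := (cubeLamS L a M ρ k, cubeLamBP' L a M ρ k)`.  Level `0`: `cubeLamB`'s own law; level `n+1`: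
print's «at least one end-point in `□_j^{(j)}`» splits into both-ends (inner) ∕ one-end (crossing, `block_mem_cubeLamS_of_adjacent`).
[cite: Balaban1985RegularSpaces, (1.31) p.82 («All sites of the contours Γ_{b₋,x} belong to Λ_{j−1}»), (1.5) p.77, (1.131) p.99; Balaban1984PropagatorsII, (2.3) p.224] -/
theorem cubeLamBP'_hclass {L : ℕ} (hL : 1 ≤ L) (a : Site d) (M : ℕ) {ρ : ℕ} (hρ : L ≤ ρ) (k : ℕ) :
    ∀ m, m ≤ k → ∀ j, j ≤ m → ∀ c ∈ cubeLamBP' L a M ρ k m j,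
      (c.1 ∈ cubeLamS L a M ρ k m j ∧ c.1 + e c.2 ∈ cubeLamS L a M ρ k m j) ∨
      (∃ j', j = j' + 1 ∧ (∀ x, (L : ℤ) • c.1 ≤ x → x ≤ (L : ℤ) • c.1 + blockTop L → x ∈ cubeLamS L a M ρ k m j') ∧
        c.1 + e c.2 ∈ cubeLamS L a M ρ k m j) ∨
      (∃ j', j = j' + 1 ∧ c.1 ∈ cubeLamS L a M ρ k m j ∧
        (∀ x, (L : ℤ) • (c.1 + e c.2) ≤ x → x ≤ (L : ℤ) • (c.1 + e c.2) + blockTop L → x ∈ cubeLamS L a M ρ k m j')) := by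
  intro m hm j hj c hc
  rcases Nat.eq_zero_or_pos j with rfl | hj1
  · rw [cubeLamBP'_zero] at hc
    exact hclass_cubeLamB L a M ρ k m hm 0 hj c hc
  · obtain ⟨n, rfl⟩ : ∃ n, j = n + 1 := ⟨j - 1, by omega⟩
    rw [cubeLamBP'_of_ne_zero L a M ρ k m (Nat.succ_ne_zero n), mem_cubeLamBP_iff] at hc
    obtain ⟨-, hends, hdeep⟩ := hc
    -- adjacency of the two ends
    have hadj₁ : ∀ i, (c.1 + e c.2) i - 1 ≤ c.1 i ∧ c.1 i ≤ (c.1 + e c.2) i + 1 := by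
      intro i
      simp only [Pi.add_apply, e, Pi.single_apply]
      split_ifs <;> constructor <;> omega
    have hadj₂ : ∀ i, c.1 i - 1 ≤ (c.1 + e c.2) i ∧ (c.1 + e c.2) i ≤ c.1 i + 1 := by
      intro i
      simp only [Pi.add_apply, e, Pi.single_apply]
      split_ifs <;> constructor <;> omega
    by_cases hcm : InBox (sqLo L a ρ k (n + 1)) (sqHi L a M ρ k (n + 1)) c.1
    · by_cases hcp : InBox (sqLo L a ρ k (n + 1)) (sqHi L a M ρ k (n + 1)) (c.1 + e c.2)
      · -- INNER
        exact Or.inl ⟨mem_cubeLamS_of_inBox L a M ρ hj hm hcm fun h => (hdeep h).1,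
          mem_cubeLamS_of_inBox L a M ρ hj hm hcp fun h => (hdeep h).2⟩
      · -- MIRRORED-CROSSING: `c₋ ∈ □_j^{(j)}`, `c₊` outside
        exact Or.inr (Or.inr ⟨n, rfl, mem_cubeLamS_of_inBox L a M ρ hj hm hcm fun h => (hdeep h).1,
          block_mem_cubeLamS_of_adjacent hL a M hρ hj hm hcm hcp hadj₂⟩)
    · -- CROSSING: `c₋` outside, so `c₊ ∈ □_j^{(j)}`
      have hcp : InBox (sqLo L a ρ k (n + 1)) (sqHi L a M ρ k (n + 1)) (c.1 + e c.2) := hends.resolve_left hcm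
      exact Or.inr (Or.inl ⟨n, rfl, block_mem_cubeLamS_of_adjacent hL a M hρ hj hm hcp hcm hadj₁,
        mem_cubeLamS_of_inBox L a M ρ hj hm hcp fun h => (hdeep h).2⟩)

#print axioms cubeLamBP'_hbox_pred
#print axioms cubeLamBP'_hclass

end Literature.MathematicalPhysics.QuantumFieldTheory.Balaban1983to89.B8CubeMemberLamBPrimeLaws

end
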